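import Summits.ABC.IUTFork.Thm311RealInd1StripTwistJW
import Summits.ABC.IUTFork.Thm311RealInd1StripSymplecticKit
import Mathlib.LinearAlgebra.SymplecticGroup
import HarnessLib

/-!
# [IUTchIII] Thm 3.11 (i) (Ind1) at `v ∈ 𝕍^non`: the MAPPING-CLASS-GROUP part of print's strip part — every `A ∈ Sp_{2g}(ℤ)` acts on
# `K_v^{(1/n_v)}` as `diag(1, A)` in the Jannsen–Wingberg log-basis through a REALISED strip automorphism (modulo `JannsenWingbergMappingClass`)

PROOF-ONLY file (abc-iut cell, Cor. 3.12 sub-crew, seat abc-iut-c312-1 = holder of record of the typed [IUTchIII] Thm. 3.11, gen 14; row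
«R18 JW-MAPPING-CLASS-IMAGE», part c — the consumer of the new named fact `JannsenWingbergMappingClass` (v4 of
`Literature/AnabelianGeometry/AbsoluteAnabelian/MLFGaloisJannsenWingbergTwists.lean`; K. Kondo, arXiv:2512.09231 §3 Thm. 3.17 / Rem. 3.18 over
Farb–Margalit PMS-49 Thm. 6.4; C LEAD ruling C-R111 (a) GO).  TAKES NO SIDE on [IUTchIII] Cor. 3.12.

Gen 11 (`dehnTwists_closureAt_of_jannsenWingberg`, p493323) realised Kondo's PLANE TWISTS in print's (Ind1) strip part; R17b/R17d (gen 14) drew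
the orbit-span consequences plane by plane.  The planes do not mix under those twists; what mixes them is the mapping-class-group part of
`Aut(G_k)` (Kondo §3): for `d = [K_v:ℚ_p] = 1 + 2g` odd, every `A ∈ Sp_{2g}(ℤ)` is the abelianised plane action of an automorphism of `G_v` fixing
`σ, τ, x_0, x_1`.  THIS FILE proves, from that named fact (binder `hMC`), by the route of gen 11 (Hoshi–Nishio Lem. 1.3 spanning + THE equivariant
lift read through `θ`, kit `liftUnits_eq_prod_zpow_of_theta` / `of_galoisLog_liftUnits_eq_sum_of_theta` + `of_galoisLog_liftUnits_eq_of_generators`):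
* **`exists_realised_symplectic_of_jannsenWingbergMappingClass`** — at `v ∣ p` odd with `d = [K_v : ℚ_p] ≥ 3` ODD there are `g` (`d = 1 + 2g`) and a
  `ℚ_p`-basis `y : Fin 1 ⊕ Fin g × Fin 2` of `K_v^{(1/n_v)}` (`y_{inl 0} = log u_1`, `y_{(i,0)} = log u_{2i+2}`, `y_{(i,1)} = log u_{2i+3}` — the
  logarithms of the Jannsen–Wingberg principal units) such that for EVERY `A ∈ Sp_{2g}(ℤ)` (Mathlib `Matrix.symplecticGroup (Fin g) ℤ`, planes
  indexed by `Fin g ⊕ Fin g`) some `ψ_A ∈ Real.ind1StripOf v (Real.galoisLog v)` acts as `diag(1, Aᵀ)`: `ψ_A` fixes `y_{inl 0}` and sends `y_c` to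
  `Σ_r A_{rc}·y_r` on the plane vectors — print's (Ind1) strip part at `v`, AS TYPED (THE equivariant lift, THE logarithm), contains a copy of
  `Sp_{2g}(ℤ)` acting on the plane lattice.
HONEST SCOPE: conditional on `hMC : JannsenWingbergMappingClass` (a 2025 preprint's §3 over a textbook theorem; displayed as a binder); single
place; statements about OUR typed objects; the consequences for orbit spans / hulls (the canonical identity `span = M + p^k·(log_p(𝒪_v^×) ∩ Ker Tr)`
without the «full plane contents» proviso of R17d) are the sequel; nothing here asserts or refutes [IUTchIII] Cor. 3.12; NO abc claim.
[claim: Mochizuki2012, status: disputed]; [cite: Kondo2025OuterAutMLF, §3 p.18 l.40–61, Thm 3.17, Rem 3.18]; [cite: FarbMargalit2012, Thm 6.4 p.147];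
[cite: HoshiNishio2022OuterAutMLF, Lemma 1.3]; [cite: JannsenWingberg1982, Thm 2 p.75]. typed ≠ proved; a conditional theorem discharges nothing it binds.
-/

set_option autoImplicit false

noncomputable section

open Metric Set
open scoped Pointwise

namespace Summit.ABC.IUTFork.Thm311.Real

open NumberField IsDedekindDomain Literature.NumberTheory.NumberFields Literature.IUT.LogVolume
open Literature.NumberTheory.GaloisRepresentations
open Literature.AnabelianGeometry.AbsoluteAnabelian Literature.IUT.HodgeArakelov
open Literature.IUT.HodgeArakelov.AbsTopMonoids

variable {F : Type} [Field F] [NumberField F] (v : HeightOneSpectrum (𝓞 F))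

/-- **`Sp_{2g}(ℤ)` REALISED IN PRINT's (Ind1) STRIP PART (modulo `JannsenWingbergMappingClass`), ODD local degree.**  At `v ∣ p` odd with
`d = [K_v : ℚ_p] ≥ 3` ODD there are `g` with `d = 1 + 2g` and a `ℚ_p`-basis `y : Fin 1 ⊕ Fin g × Fin 2` of `K_v^{(1/n_v)}` such that for every
integer symplectic matrix `A ∈ Sp_{2g}(ℤ)` (planes indexed by `Fin g ⊕ Fin g`: `inl i ↔ (i,0)`, `inr i ↔ (i,1)`) there is
`ψ ∈ Real.ind1StripOf v (Real.galoisLog v)` with `ψ(x) = y^*_{inl 0}(x)·y_{inl 0} + Σ_c y^*_c(x)·(Σ_r A_{rc}·y_r)` (`c, r` over the plane indices):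
`ψ` fixes the residual vector and acts on the plane vectors by `A` (column `c` of `A` = coordinates of `ψ(y_c)`).  Route: the fact's `φ_A` fixes
`x_0, x_1` and has abelianised plane action `A`; THE equivariant lift then sends `u_c ↦ Π_r u_r^{A_{rc}}` (kit, via `θ`), so `log ∘ liftUnits φ_A`
is the `ℚ_p`-linear map `T_A` on the generators' logarithms, hence on all of `log(𝒪_v^×)` (gen 11 `of_galoisLog_liftUnits_eq_of_generators`);
`T_A` is onto (its range contains `log(𝒪_v^×)`, which spans) hence bijective, and `ψ := T_A` read on `K_v` realises `φ_A`.
[claim: Mochizuki2012, status: disputed] [cite: Kondo2025OuterAutMLF, §3 Thm 3.17, Rem 3.18] [cite: FarbMargalit2012, Thm 6.4 p.147]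
[cite: HoshiNishio2022OuterAutMLF, Lemma 1.3] -/
theorem exists_realised_symplectic_of_jannsenWingbergMappingClass (hMC : JannsenWingbergMappingClass)
    (p : ℕ) [Fact p.Prime] (hv : ((p : ℕ) : 𝓞 F) ∈ v.asIdeal) (hp2 : p ≠ 2) (h3 : 3 ≤ localDeg F v) (hodd : Odd (localDeg F v)) :
    ∃ (g : ℕ) (_ : localDeg F v = 1 + 2 * g) (y : Module.Basis (Fin 1 ⊕ Fin g × Fin 2) ℚ_[p] (RescaledCompletion F p v hv)),
      ∀ A : Matrix (Fin g ⊕ Fin g) (Fin g ⊕ Fin g) ℤ, A ∈ Matrix.symplecticGroup (Fin g) ℤ →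
        ∃ ψ : v.adicCompletion F ≃+ v.adicCompletion F, ψ ∈ ind1StripOf v (galoisLog v) ∧
          ∀ x : RescaledCompletion F p v hv,
            RescaledCompletion.of F p v hv (ψ ((RescaledCompletion.of F p v hv).symm x)) =
              y.coord (Sum.inl 0) x • y (Sum.inl 0) +
                ∑ c : Fin g ⊕ Fin g, y.coord (Sum.inr (Sum.elim (fun i => (i, 0)) (fun i => (i, 1)) c)) x •
                  ∑ r : Fin g ⊕ Fin g, (A r c : ℚ_[p]) • y (Sum.inr (Sum.elim (fun i => (i, 0)) (fun i => (i, 1)) r)) := by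
  -- `p` IS the residue characteristic of `K_v`; notation and structures as in gen 11
  obtain rfl : p = (closureAt v).residueChar := eq_residueChar_closureAt_of_natCast_mem v hv
  have hpk : ValuativeRel.valuation (v.adicCompletion F) (closureAt v).residueChar < 1 :=
    LocalField.valuation_adicCompletion_natCast_lt_one v (closureAt v).residueChar hv
  haveI : CharZero (v.adicCompletion F) := charZero_adicCompletion v
  letI iQ : Algebra ℚ_[(closureAt v).residueChar] (v.adicCompletion F) :=
    LocalField.padicAlgebra (v.adicCompletion F) (closureAt v).residueChar hpk
  haveI : ValuativeExtension (v.adicCompletion F) (v.adicCompletion F) := ⟨fun _ _ => Iff.rfl⟩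
  haveI : FiniteDimensional ℚ_[(closureAt v).residueChar] (RescaledCompletion F (closureAt v).residueChar v hv) :=
    FiniteDimensional.of_locallyCompactSpace ℚ_[(closureAt v).residueChar]
  set d := Module.finrank ℚ_[(closureAt v).residueChar] (v.adicCompletion F) with hd
  have hlocal : localDeg F v = d := by
    exact RescaledCompletion.localDeg_eq_finrank F (closureAt v).residueChar v hv
  -- `d` odd `≥ 3`: `d = 1 + 2g`, `g ≥ 1`
  obtain ⟨m, hm⟩ := hodd
  set g : ℕ := m with hg
  have hdg : d = 1 + 2 * g := by omega
  have hg1 : 1 ≤ g := by omega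
  -- the Jannsen–Wingberg data with the mapping-class-group image at `K_v`
  obtain ⟨σ, τ, x, u, s, H, -, -, hwild, hdense, hs, hH, htor, -, hsp⟩ :=
    hMC (v.adicCompletion F) (closureAt v).residueChar hpk hp2 g hg1 hdg
  -- the principal units `u_j` as units of `𝒪_v`
  have hunit : ∀ j, j ≤ d → ∃ w : (↥(v.adicCompletionIntegers F))ˣ, unitsToK v w = u j := by
    intro j hj
    apply exists_unit_coe_eq
    rw [Valuation.mem_unitGroup_iff]
    have h := Valuation.map_one_add_of_lt (ValuativeRel.valuation (v.adicCompletion F)) (hwild j hj).1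
    rwa [add_sub_cancel] at h
  choose! uO huO using hunit
  set S : Set (↥(v.adicCompletionIntegers F))ˣ := uO '' Set.Iic d with hSdef
  have hSmap : (Subgroup.closure S).map (unitsToK v) = Subgroup.closure (u '' Set.Iic d) := by
    rw [MonoidHom.map_closure]
    congr 1
    ext z
    constructor
    · rintro ⟨w, ⟨j, hj, rfl⟩, rfl⟩; exact ⟨j, hj, (huO j hj).symm⟩
    · rintro ⟨j, hj, rfl⟩; exact ⟨uO j, ⟨j, hj, rfl⟩, huO j hj⟩
  have hS : ∀ w : (↥(v.adicCompletionIntegers F))ˣ,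
      ValuativeRel.valuation (v.adicCompletion F) (((w : ↥(v.adicCompletionIntegers F)) : v.adicCompletion F) - 1) < 1 →
        unitsToK v w ∈ (((Subgroup.closure S).map (unitsToK v)).topologicalClosure : Subgroup (v.adicCompletion F)ˣ) := by
    intro w hw
    rw [hSmap]
    exact hdense (unitsToK v w) hw
  -- the logarithms `y_j`, read in the rescaled completion
  set e := RescaledCompletion.of F (closureAt v).residueChar v hv with he
  let yR : ℕ → RescaledCompletion F (closureAt v).residueChar v hv := fun j => e (galoisLog v (Additive.ofMul (uO j)))
  -- (Hoshi–Nishio Lemma 1.3, spanning) every element is in the span of `y_0, …, y_d`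
  have hspan : ∀ z, z ∈ Submodule.span ℚ_[(closureAt v).residueChar] (yR '' Set.Iic d) := by
    intro z
    have h := mem_span_of_galoisLog_of_generators v (closureAt v).residueChar hv S hS z
    rwa [hSdef, Set.image_image] at h
  -- the abelianised relation: `H • y_0 + p^s • y_1 = 0`, so `y_0 ∈ ℚ_p·y_1`
  have htor' : IsOfFinOrder (uO 0 ^ H * uO 1 ^ ((closureAt v).residueChar ^ s)) := by
    have hmap : unitsToK v (uO 0 ^ H * uO 1 ^ ((closureAt v).residueChar ^ s)) =
        u 0 ^ H * u 1 ^ ((closureAt v).residueChar ^ s) := by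
      rw [map_mul, map_zpow, map_pow, huO 0 (by omega), huO 1 (by omega)]
    obtain ⟨n, hn, hpow⟩ := htor.exists_pow_eq_one
    exact isOfFinOrder_iff_pow_eq_one.mpr ⟨n, hn, unitsToK_injective v (by rw [map_pow, hmap, hpow, map_one])⟩
  have hrel : (H : ℚ_[(closureAt v).residueChar]) • yR 0 +
      (((closureAt v).residueChar ^ s : ℕ) : ℚ_[(closureAt v).residueChar]) • yR 1 = 0 := by
    obtain ⟨n, hn, hpow⟩ := htor'.exists_pow_eq_one
    have h0 : galoisLog v (Additive.ofMul (uO 0 ^ H * uO 1 ^ ((closureAt v).residueChar ^ s))) = 0 := by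
      have h1 : (n : v.adicCompletion F) *
          galoisLog v (Additive.ofMul (uO 0 ^ H * uO 1 ^ ((closureAt v).residueChar ^ s))) = 0 := by
        rw [← nsmul_eq_mul, ← map_nsmul, ← ofMul_pow, hpow, ofMul_one, map_zero]
      exact (mul_eq_zero.mp h1).resolve_left (by exact_mod_cast hn.ne')
    rw [ofMul_mul, ofMul_zpow, ofMul_pow, map_add, map_zsmul, map_nsmul] at h0
    have h1 := congrArg e h0
    rw [map_add, map_zsmul, map_nsmul, map_zero, ← Int.cast_smul_eq_zsmul ℚ_[(closureAt v).residueChar],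
      ← Nat.cast_smul_eq_nsmul ℚ_[(closureAt v).residueChar]] at h1
    exact h1
  have hy0 : yR 0 ∈ Submodule.span ℚ_[(closureAt v).residueChar] {yR 1} := by
    have hH0 : (H : ℚ_[(closureAt v).residueChar]) ≠ 0 := by exact_mod_cast hH
    have h1 : (H : ℚ_[(closureAt v).residueChar]) • yR 0 =
        -((((closureAt v).residueChar ^ s : ℕ) : ℚ_[(closureAt v).residueChar]) • yR 1) :=
      eq_neg_of_add_eq_zero_left hrel
    have h : yR 0 = (H : ℚ_[(closureAt v).residueChar])⁻¹ •
        (-((((closureAt v).residueChar ^ s : ℕ) : ℚ_[(closureAt v).residueChar]) • yR 1)) := by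
      rw [← h1, smul_smul, inv_mul_cancel₀ hH0, one_smul]
    rw [h, ← smul_neg, smul_smul]
    exact Submodule.smul_mem _ _ (Submodule.neg_mem _ (Submodule.mem_span_singleton_self _))
  -- hence `y_1, …, y_d` span
  have hspan1 : ∀ z, z ∈ Submodule.span ℚ_[(closureAt v).residueChar] (yR '' Set.Icc 1 d) := by
    intro z
    have hsub : yR '' Set.Iic d ⊆ (Submodule.span ℚ_[(closureAt v).residueChar] (yR '' Set.Icc 1 d) :
        Set (RescaledCompletion F (closureAt v).residueChar v hv)) := by
      rintro _ ⟨j, hj, rfl⟩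
      rcases Nat.eq_zero_or_pos j with rfl | hjpos
      · refine Submodule.span_mono ?_ hy0
        rintro _ rfl
        exact ⟨1, ⟨le_rfl, by omega⟩, rfl⟩
      · exact Submodule.subset_span ⟨j, ⟨hjpos, hj⟩, rfl⟩
    exact Submodule.span_le.mpr hsub (hspan z)
  -- Kondo's indexing, odd case (`c = 1`): `inl 0 ↦ 1`, `inr (i, ε) ↦ 2i + 2 + ε`
  let idx : Fin 1 ⊕ Fin g × Fin 2 → ℕ := fun s' =>
    Sum.elim (fun t : Fin 1 => (t : ℕ) + 1) (fun iε : Fin g × Fin 2 => 1 + 2 * (iε.1 : ℕ) + 1 + (iε.2 : ℕ)) s'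
  have hidx_inj : Function.Injective idx := jwIndex_injective 1 g
  have hidx_mem : ∀ s', 1 ≤ idx s' ∧ idx s' ≤ d := by
    rintro (t | ⟨i, ε⟩)
    · have := t.2; simp only [idx, Sum.elim_inl]; omega
    · have := i.2; have := ε.2; simp only [idx, Sum.elim_inr]; omega
  -- the plane indexing of the fact: `pl : Fin g ⊕ Fin g → Fin g × Fin 2`, `idx (inr (pl r)) = 2r+2 / 2r+3`
  let pl : Fin g ⊕ Fin g → Fin g × Fin 2 := Sum.elim (fun i => (i, 0)) (fun i => (i, 1))
  have hpl : ∀ r : Fin g ⊕ Fin g,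
      idx (Sum.inr (pl r)) = Sum.elim (fun i : Fin g => 2 * (i : ℕ) + 2) (fun i : Fin g => 2 * (i : ℕ) + 3) r := by
    rintro (i | i) <;> simp only [idx, pl, Sum.elim_inl, Sum.elim_inr, Fin.val_zero, Fin.val_one] <;> omega
  -- the basis of `K_v^{(1/n_v)}`
  let bfam : Fin 1 ⊕ Fin g × Fin 2 → RescaledCompletion F (closureAt v).residueChar v hv := fun s' => yR (idx s')
  have hle : ⊤ ≤ Submodule.span ℚ_[(closureAt v).residueChar] (Set.range bfam) := by
    intro z _
    have hsub : yR '' Set.Icc 1 d ⊆ Set.range bfam := by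
      rintro _ ⟨j, ⟨hj1, hj2⟩, rfl⟩
      obtain ⟨s', hs'⟩ := exists_jwIndex_eq 1 g hj1 (by omega)
      exact ⟨s', by simp only [bfam, idx]; rw [hs']⟩
    exact Submodule.span_mono hsub (hspan1 z)
  have hcard : Fintype.card (Fin 1 ⊕ Fin g × Fin 2) =
      Module.finrank ℚ_[(closureAt v).residueChar] (RescaledCompletion F (closureAt v).residueChar v hv) := by
    have hfinR : Module.finrank ℚ_[(closureAt v).residueChar] (RescaledCompletion F (closureAt v).residueChar v hv) = localDeg F v :=
      (RescaledCompletion.localDeg_eq_finrank F (closureAt v).residueChar v hv).symm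
    rw [hfinR, Fintype.card_sum, Fintype.card_prod, Fintype.card_fin, Fintype.card_fin, Fintype.card_fin]
    omega
  let y : Module.Basis (Fin 1 ⊕ Fin g × Fin 2) ℚ_[(closureAt v).residueChar]
      (RescaledCompletion F (closureAt v).residueChar v hv) := basisOfTopLeSpanOfCardEqFinrank bfam hle hcard
  have hyb : ∀ s', y s' = yR (idx s') := fun s' => by
    change (basisOfTopLeSpanOfCardEqFinrank bfam hle hcard : _ → _) s' = _
    rw [coe_basisOfTopLeSpanOfCardEqFinrank]
  -- `[x_j] = θ (u_j)` on the units of `𝒪_v`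
  have hθ : ∀ j, j ≤ d → absGaloisAbProj (v.adicCompletion F) (x j) =
      (LocalWeilDatum.isReciprocitySystemE (F := v.adicCompletion F) (E := v.adicCompletion F)
        (LocalWeilDatum.isClassFieldTheory_localWeilDatum (v.adicCompletion F))).theta (unitsToK v (uO j)) := by
    intro j hj; rw [huO j hj]; exact (hwild j hj).2
  refine ⟨g, by omega, y, fun A hA => ?_⟩
  -- the automorphism of the fact for `A`
  obtain ⟨φ, -, -, hφ0, hφ1, hφA⟩ := hsp A hA
  -- THE lift on the generators: `u_0, u_1` fixed, plane generators by `A`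
  have hL0 : liftUnits v φ (uO 0) = uO 0 :=
    liftUnits_eq_of_theta v φ (hθ 0 (by omega)) ((congrArg (absGaloisAbProj (v.adicCompletion F)) hφ0).trans (hθ 0 (by omega)))
  have hL1 : liftUnits v φ (uO 1) = uO 1 :=
    liftUnits_eq_of_theta v φ (hθ 1 (by omega)) ((congrArg (absGaloisAbProj (v.adicCompletion F)) hφ1).trans (hθ 1 (by omega)))
  have hLA : ∀ c : Fin g ⊕ Fin g, e (galoisLog v (Additive.ofMul (liftUnits v φ (uO (idx (Sum.inr (pl c))))))) =
      ∑ r : Fin g ⊕ Fin g, (A r c : ℚ_[(closureAt v).residueChar]) • yR (idx (Sum.inr (pl r))) := by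
    intro c
    have h := of_galoisLog_liftUnits_eq_sum_of_theta v (closureAt v).residueChar hv φ
      (fun r : Fin g ⊕ Fin g => x (idx (Sum.inr (pl r)))) (fun r => uO (idx (Sum.inr (pl r))))
      (fun r => hθ _ (hidx_mem _).2) A c ?_
    · exact h
    · simp only [hpl]
      exact hφA c
  -- the linear map `T_A`: `y_{inl 0} ↦ y_{inl 0}`, `y_{pl c} ↦ Σ_r A r c • y_{pl r}`
  let f : Fin 1 ⊕ Fin g × Fin 2 → RescaledCompletion F (closureAt v).residueChar v hv := fun s' =>
    Sum.elim (fun _ => y (Sum.inl 0))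
      (fun iε : Fin g × Fin 2 => ∑ r : Fin g ⊕ Fin g,
        (A r (![Sum.inl iε.1, Sum.inr iε.1] iε.2) : ℚ_[(closureAt v).residueChar]) • y (Sum.inr (pl r))) s'
  let T : RescaledCompletion F (closureAt v).residueChar v hv →ₗ[ℚ_[(closureAt v).residueChar]]
      RescaledCompletion F (closureAt v).residueChar v hv := y.constr ℚ_[(closureAt v).residueChar] f
  have hTb : ∀ s', T (y s') = f s' := fun s' => Module.Basis.constr_basis y ℚ_[(closureAt v).residueChar] f s'
  have hplc : ∀ c : Fin g ⊕ Fin g, (![Sum.inl (pl c).1, Sum.inr (pl c).1] (pl c).2 : Fin g ⊕ Fin g) = c := by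
    rintro (i | i) <;> rfl
  -- `T_A` agrees with `log ∘ liftUnits φ` on the generators `u_j`, `j ≤ d`
  have hgen : ∀ s' ∈ S, e (galoisLog v (Additive.ofMul (liftUnits v φ s'))) =
      (LinearMap.toContinuousLinearMap T) (e (galoisLog v (Additive.ofMul s'))) := by
    rintro _ ⟨j, hj, rfl⟩
    rw [LinearMap.coe_toContinuousLinearMap']
    rcases Nat.eq_zero_or_pos j with rfl | hjpos
    · -- `j = 0`: `u_0` is fixed and `y_0 ∈ ℚ_p·y_1` is fixed by `T`
      obtain ⟨q, hq⟩ := Submodule.mem_span_singleton.mp hy0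
      rw [hL0]
      change yR 0 = T (yR 0)
      have h1 : yR 1 = y (Sum.inl 0) := by rw [hyb]; rfl
      rw [← hq, map_smul, h1, hTb]
      rfl
    · obtain ⟨s', hs'⟩ := exists_jwIndex_eq 1 g hjpos (by have hj' : j ≤ d := hj; omega)
      have hs'' : idx s' = j := hs'
      rcases s' with t | iε
      · -- `j = 1`: fixed
        have ht : t = 0 := Subsingleton.elim _ _
        subst ht
        have hj1 : j = 1 := by rw [← hs'']; rfl
        subst hj1
        rw [hL1]
        change yR 1 = T (yR 1)
        have h1 : yR 1 = y (Sum.inl 0) := by rw [hyb]; rfl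
        rw [h1, hTb]
        rfl
      · -- a plane generator: by `A`
        have hc : iε = pl (![Sum.inl iε.1, Sum.inr iε.1] iε.2) := by
          obtain ⟨i, ε⟩ := iε
          fin_cases ε <;> rfl
        rw [← hs'', hc, hLA]
        change _ = T (yR (idx (Sum.inr (pl _))))
        rw [← hyb, hTb]
        simp only [f, Sum.elim_inr, hplc]
        refine Finset.sum_congr rfl fun r _ => ?_
        rw [hyb]
  -- hence on ALL units
  have hall := of_galoisLog_liftUnits_eq_of_generators v (closureAt v).residueChar hv S hS φ (LinearMap.toContinuousLinearMap T) hgen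
  -- `T_A` is onto (its range contains every `log w`, and these span), hence bijective
  have hsurj : Function.Surjective T := by
    rw [← LinearMap.range_eq_top, eq_top_iff]
    have hsub : yR '' Set.Iic d ⊆ (LinearMap.range T : Set (RescaledCompletion F (closureAt v).residueChar v hv)) := by
      rintro _ ⟨j, _, rfl⟩
      refine ⟨e (galoisLog v (Additive.ofMul ((liftUnits v φ).symm (uO j)))), ?_⟩
      have h := hall ((liftUnits v φ).symm (uO j))
      rw [MulEquiv.apply_symm_apply, LinearMap.coe_toContinuousLinearMap'] at h
      exact h.symm
    intro z _
    exact Submodule.span_le.mpr hsub (hspan z)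
  have hinj : Function.Injective T := LinearMap.injective_iff_surjective.mpr hsurj
  let TE : RescaledCompletion F (closureAt v).residueChar v hv ≃ₗ[ℚ_[(closureAt v).residueChar]]
      RescaledCompletion F (closureAt v).residueChar v hv := LinearEquiv.ofBijective T ⟨hinj, hsurj⟩
  have hTE : ∀ z, TE z = T z := fun z => rfl
  -- `ψ := T_A` read on `K_v`
  let ψ : v.adicCompletion F ≃+ v.adicCompletion F := e.toAddEquiv.trans (TE.toAddEquiv.trans e.symm.toAddEquiv)
  have hψ : ∀ t, ψ t = e.symm (T (e t)) := fun t => rfl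
  have hTc : Continuous T := T.continuous_of_finiteDimensional
  have hTEc : Continuous TE.symm := TE.symm.toLinearMap.continuous_of_finiteDimensional
  refine ⟨ψ, ⟨?_, ?_, φ, ?_⟩, fun z => ?_⟩
  · -- continuity of `ψ` (the identity `K_v → K_v^{(1/n_v)}` is a homeomorphism of the same space)
    exact hTc
  · exact hTEc
  · -- `ψ` realises `φ` through the Galois logarithm
    rw [realises_stripMulAut_iff]
    intro w
    rw [hψ]
    apply e.injective
    rw [e.apply_symm_apply, ← LinearMap.coe_toContinuousLinearMap' T, ← hall w]
  · -- the formula: `e ∘ ψ ∘ e⁻¹ = T_A = Σ_s y^*_s(z) • f s`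
    have hTz : e (ψ (e.symm z)) = T z := by rw [hψ, e.apply_symm_apply, e.apply_symm_apply]
    rw [hTz, Module.Basis.constr_apply_fintype, Fintype.sum_sum_type, Fin.sum_univ_one]
    simp only [Module.Basis.equivFun_apply, Module.Basis.coord_apply, f, Sum.elim_inl, Sum.elim_inr]
    congr 1
    -- reindex the plane sum along `pl : Fin g ⊕ Fin g ≃ Fin g × Fin 2`
    let toSum : Fin g × Fin 2 → Fin g ⊕ Fin g := fun iε => ![Sum.inl iε.1, Sum.inr iε.1] iε.2
    have hpt : ∀ iε, pl (toSum iε) = iε := by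
      rintro ⟨i, ε⟩
      fin_cases ε <;> rfl
    let plEquiv : Fin g ⊕ Fin g ≃ Fin g × Fin 2 := ⟨pl, toSum, fun c => hplc c, hpt⟩
    refine (Fintype.sum_equiv plEquiv _ _ fun c => ?_).symm
    show y.repr z (Sum.inr (pl c)) • ∑ r, (A r c : ℚ_[(closureAt v).residueChar]) • y (Sum.inr (pl r)) =
      y.repr z (Sum.inr (pl c)) • ∑ r, (A r (toSum (pl c)) : ℚ_[(closureAt v).residueChar]) • y (Sum.inr (pl r))
    rw [show toSum (pl c) = c from hplc c]

end Summit.ABC.IUTFork.Thm311.Real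

end
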